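import Mathlib.NumberTheory.ModularForms.CongruenceSubgroups
import Mathlib.RingTheory.Coprime.Lemmas
import Mathlib.GroupTheory.Archimedean
import HarnessLib

/-!
# Generators for `Γ¹(M)` modulo `Γ(M p)` (Diamond–Shurman Lemma 5.7.6) and a commutator lemma

Topic `Literature/NumberTheory/EllipticCurves` (Atkin–Lehner theory, companion to
`NewformsMainLemma`). Group-theoretic input of Carlton's proof of the Main Lemma
(Diamond–Shurman, *A first course in modular forms*, GTM 228, §5.7): with

* `Γ¹(M) = {γ ∈ SL(2, ℤ) | γ ≡ (1 0; * 1) mod M}` (`gammaUpper1 M`, Diamond–Shurman p. 212),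
* `T = (1 1; 0 1)` (Mathlib `ModularGroup.T`) and `L = (1 0; 1 1)` (`matL`),

we prove

* `closure_eq_gammaUpper1` (`gammaUpper1_le_closure`, `gammaUpper1_le_of_mem`): for a prime `p`,
  `Γ¹(M)` is generated by `Γ(M p)`, `T^M` and `L`.
  This is Diamond–Shurman's Lemma 5.7.6, `⟨Γ¹(p^e), Γ₁(p^e) ∩ Γ⁰(p^{e-1})⟩ = Γ¹(p^{e-1})`,
  in the form "with the prime-to-`p` part of the level carried along" that avoids the
  decomposition `SL(2, ℤ/Nℤ) = ∏ SL(2, ℤ/p^e ℤ)`: modulo `Γ(N)`, `N = M p`, the images of `L`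
  and `T^M` generate the images of `Γ¹(N)` and of `Γ₁(N) ∩ Γ⁰(M)`. The proof is the one printed
  on pp. 215–216 (move to `p ∤ a` using `L`, clear `b` and `c` modulo `N` with `T^{Mσ}` and
  `L^t`, then the four-factor identity
  `T^{1-a} L⁻¹ T^{1-d} L^{a} = (a + a(1 - ad), 1 - ad; ad - 1, d)`).
* `commutator_T_zpow_matL_zpow_mem_Gamma`: `T^b L^a T^{-b} L^{-a} ∈ Γ(N)` when `N ∣ a b`
  (so the operators attached to different primes commute on `Γ(N)`-invariants).
* `matL_mem_biSup_zpowers` (`mem_biSup_zpowers_pow_of_gcd_eq_one` in any group):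
  `L ∈ ⨆_{i ∈ s} ⟨L^{a i}⟩` when `gcd_{i ∈ s} a i = 1`, and
  `Nat.gcd_primeFactors_ordCompl_eq_one`: `gcd_{q ∣ N} N / q^{v_q(N)} = 1` for `N ≥ 2`
  (so `L ∈ ⨆_{q ∣ N} ⟨L^{N / q^{v_q(N)}}⟩`).

## References

* F. Diamond, J. Shurman, *A first course in modular forms*, GTM 228, Springer 2005, §5.7,
  Lemma 5.7.6 and its proof (PDF pp. 214–216). doi:10.1007/978-0-387-27226-9
-/

open Matrix Matrix.SpecialLinearGroup CongruenceSubgroup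

open scoped MatrixGroups ModularGroup

namespace Literature.NumberTheory.EllipticCurves.ModularForms

/-! ### The matrix `L = (1 0; 1 1)` and the group `Γ¹(M)` -/

/-- The unipotent lower triangular matrix `L = (1 0; 1 1) ∈ SL(2, ℤ)` (it generates `Γ¹(N)`
modulo `Γ(N)`). [folklore] -/
def matL : SL(2, ℤ) :=
  ⟨!![1, 0; 1, 1], by simp [Matrix.det_fin_two_of]⟩

/-- Unfolding lemma. [folklore] -/
@[simp] lemma coe_matL : (matL : Matrix (Fin 2) (Fin 2) ℤ) = !![1, 0; 1, 1] := rfl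

/-- `L⁻¹ = (1 0; -1 1)`. [folklore] -/
lemma coe_matL_inv : ((matL⁻¹ : SL(2, ℤ)) : Matrix (Fin 2) (Fin 2) ℤ) = !![1, 0; -1, 1] := by
  simp [coe_inv, coe_matL, adjugate_fin_two]

/-- `Lⁿ = (1 0; n 1)`. [folklore] -/
lemma coe_matL_zpow (n : ℤ) : ((matL ^ n : SL(2, ℤ)) : Matrix (Fin 2) (Fin 2) ℤ) =
    !![1, 0; n, 1] := by
  induction n with
  | zero => rw [zpow_zero, coe_one, Matrix.one_fin_two]
  | succ n h =>
    simp_rw [zpow_add, zpow_one, coe_mul, h, coe_matL, Matrix.mul_fin_two]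
    congrm !![_, _; ?_, _]
    ring
  | pred n h =>
    simp_rw [zpow_sub, zpow_one, coe_mul, h, coe_matL_inv, Matrix.mul_fin_two]
    congrm !![?_, _; ?_, ?_] <;> ring

/-- The congruence subgroup `Γ¹(M) = {γ ∈ SL(2, ℤ) | γ ≡ (1 0; * 1) mod M}` (Diamond–Shurman
§5.7, p. 212; the transpose of `Γ₁(M)`). [cite: DiamondShurman2005, §5.7 p. 212] -/
def gammaUpper1 (M : ℕ) : Subgroup SL(2, ℤ) where
  carrier := {γ | ((γ 0 0 : ℤ) : ZMod M) = 1 ∧ ((γ 0 1 : ℤ) : ZMod M) = 0 ∧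
    ((γ 1 1 : ℤ) : ZMod M) = 1}
  one_mem' := by simp
  mul_mem' {γ δ} hγ hδ := by
    obtain ⟨h1, h2, h3⟩ := hγ
    obtain ⟨h1', h2', h3'⟩ := hδ
    simp [Matrix.mul_apply, Fin.sum_univ_two, h1, h2, h3, h1', h2', h3']
  inv_mem' {γ} hγ := by
    obtain ⟨h1, h2, h3⟩ := hγ
    simp [coe_inv, adjugate_fin_two, h1, h2, h3]

/-- Unfolding lemma. [folklore] -/
lemma mem_gammaUpper1_iff {M : ℕ} {γ : SL(2, ℤ)} : γ ∈ gammaUpper1 M ↔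
    ((γ 0 0 : ℤ) : ZMod M) = 1 ∧ ((γ 0 1 : ℤ) : ZMod M) = 0 ∧ ((γ 1 1 : ℤ) : ZMod M) = 1 :=
  Iff.rfl

/-- Divisibility form of membership in `Γ¹(M)`. [folklore] -/
lemma mem_gammaUpper1_iff_dvd {M : ℕ} {γ : SL(2, ℤ)} : γ ∈ gammaUpper1 M ↔
    (M : ℤ) ∣ γ 0 0 - 1 ∧ (M : ℤ) ∣ γ 0 1 ∧ (M : ℤ) ∣ γ 1 1 - 1 := by
  rw [mem_gammaUpper1_iff, ← ZMod.intCast_zmod_eq_zero_iff_dvd,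
    ← ZMod.intCast_zmod_eq_zero_iff_dvd, ← ZMod.intCast_zmod_eq_zero_iff_dvd, Int.cast_sub,
    Int.cast_sub, Int.cast_one, sub_eq_zero, sub_eq_zero]

/-- `Γ(N) ≤ Γ¹(M)` for `M ∣ N`. [folklore] -/
lemma Gamma_le_gammaUpper1 {M N : ℕ} (h : M ∣ N) : Gamma N ≤ gammaUpper1 M := by
  intro γ hγ
  rw [Gamma_mem] at hγ
  obtain ⟨h1, h2, -, h4⟩ := hγ
  refine ⟨?_, ?_, ?_⟩
  · have := (ZMod.castHom h (ZMod M)).congr_arg h1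
    rwa [map_intCast, map_one] at this
  · have := (ZMod.castHom h (ZMod M)).congr_arg h2
    rwa [map_intCast, map_zero] at this
  · have := (ZMod.castHom h (ZMod M)).congr_arg h4
    rwa [map_intCast, map_one] at this

/-- `Γ¹(N) ≤ Γ¹(M)` for `M ∣ N`. [folklore] -/
lemma gammaUpper1_mono {M N : ℕ} (h : M ∣ N) : gammaUpper1 N ≤ gammaUpper1 M := by
  intro γ hγ
  obtain ⟨h1, h2, h3⟩ := hγ
  refine ⟨?_, ?_, ?_⟩
  · have := (ZMod.castHom h (ZMod M)).congr_arg h1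
    rwa [map_intCast, map_one] at this
  · have := (ZMod.castHom h (ZMod M)).congr_arg h2
    rwa [map_intCast, map_zero] at this
  · have := (ZMod.castHom h (ZMod M)).congr_arg h3
    rwa [map_intCast, map_one] at this

/-- `L ∈ Γ¹(M)`. [folklore] -/
lemma matL_mem_gammaUpper1 (M : ℕ) : matL ∈ gammaUpper1 M := by
  simp [mem_gammaUpper1_iff]

/-- `Lᵗ ∈ Γ¹(M)`. [folklore] -/
lemma matL_zpow_mem_gammaUpper1 (M : ℕ) (t : ℤ) : matL ^ t ∈ gammaUpper1 M :=
  (gammaUpper1 M).zpow_mem (matL_mem_gammaUpper1 M) t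

/-- `T^{M k} ∈ Γ¹(M)`. [folklore] -/
lemma T_zpow_mul_mem_gammaUpper1 (M : ℕ) (k : ℤ) :
    ModularGroup.T ^ ((M : ℤ) * k) ∈ gammaUpper1 M := by
  refine ⟨?_, ?_, ?_⟩ <;> simp [ModularGroup.coe_T_zpow]

/-- `T^M ∈ Γ¹(M)`. [folklore] -/
lemma T_pow_mem_gammaUpper1 (M : ℕ) : ModularGroup.T ^ M ∈ gammaUpper1 M := by
  have := T_zpow_mul_mem_gammaUpper1 M 1
  rwa [mul_one, zpow_natCast] at this

/-! ### Entries of the elementary moves -/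

/-- `γ T^n = (a, a n + b; c, c n + d)`. [folklore] -/
lemma coe_mul_T_zpow (γ : SL(2, ℤ)) (n : ℤ) :
    ((γ * ModularGroup.T ^ n : SL(2, ℤ)) : Matrix (Fin 2) (Fin 2) ℤ) =
      !![γ 0 0, γ 0 0 * n + γ 0 1; γ 1 0, γ 1 0 * n + γ 1 1] := by
  rw [coe_mul, ModularGroup.coe_T_zpow]
  ext i j
  fin_cases i <;> fin_cases j <;> simp [Matrix.mul_apply, Fin.sum_univ_two]

/-- `L^t γ = (a, b; t a + c, t b + d)`. [folklore] -/
lemma coe_matL_zpow_mul (γ : SL(2, ℤ)) (t : ℤ) :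
    ((matL ^ t * γ : SL(2, ℤ)) : Matrix (Fin 2) (Fin 2) ℤ) =
      !![γ 0 0, γ 0 1; t * γ 0 0 + γ 1 0, t * γ 0 1 + γ 1 1] := by
  rw [coe_mul, coe_matL_zpow]
  ext i j
  fin_cases i <;> fin_cases j <;> simp [Matrix.mul_apply, Fin.sum_univ_two]

/-- `γ L = (a + b, b; c + d, d)`. [folklore] -/
lemma coe_mul_matL (γ : SL(2, ℤ)) :
    ((γ * matL : SL(2, ℤ)) : Matrix (Fin 2) (Fin 2) ℤ) =
      !![γ 0 0 + γ 0 1, γ 0 1; γ 1 0 + γ 1 1, γ 1 1] := by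
  rw [coe_mul, coe_matL]
  ext i j
  fin_cases i <;> fin_cases j <;> simp [Matrix.mul_apply, Fin.sum_univ_two]

/-- The four-factor identity of Diamond–Shurman p. 215:
`T^{1-a} L⁻¹ T^{1-d} L^{a} = (a + a(1 - ad), 1 - ad; ad - 1, d)`. [cite: DiamondShurman2005, §5.7 p. 215] -/
lemma coe_fourFactor (a d : ℤ) :
    ((ModularGroup.T ^ (1 - a) * matL ^ (-1 : ℤ) * ModularGroup.T ^ (1 - d) * matL ^ a :
      SL(2, ℤ)) : Matrix (Fin 2) (Fin 2) ℤ) =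
      !![a + a * (1 - a * d), 1 - a * d; a * d - 1, d] := by
  simp only [coe_mul, ModularGroup.coe_T_zpow, coe_matL_zpow, Matrix.mul_fin_two]
  congrm !![?_, ?_; ?_, ?_] <;> ring

/-! ### Congruences modulo `Γ(N)` -/

/-- Two elements of `SL(2, ℤ)` with congruent entries differ by an element of `Γ(N)`:
`γ δ⁻¹ ∈ Γ(N)`. [folklore] -/
lemma mul_inv_mem_Gamma_of_forall {N : ℕ} {γ δ : SL(2, ℤ)}
    (h : ∀ i j, ((γ i j : ℤ) : ZMod N) = ((δ i j : ℤ) : ZMod N)) : γ * δ⁻¹ ∈ Gamma N := by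
  rw [Gamma_mem', map_mul, map_inv, mul_inv_eq_one]
  ext i j
  simpa using h i j

/-- If `γ ≡ δ (mod N)` entrywise, `δ ∈ Δ` and `Γ(N) ≤ Δ` then `γ ∈ Δ`. [folklore] -/
lemma mem_of_forall_congr {N : ℕ} {Δ : Subgroup SL(2, ℤ)} (hΓ : Gamma N ≤ Δ) {γ δ : SL(2, ℤ)}
    (hδ : δ ∈ Δ) (h : ∀ i j, ((γ i j : ℤ) : ZMod N) = ((δ i j : ℤ) : ZMod N)) : γ ∈ Δ := by
  have : γ = γ * δ⁻¹ * δ := by group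
  rw [this]
  exact Δ.mul_mem (hΓ (mul_inv_mem_Gamma_of_forall h)) hδ

/-- **Commutator lemma.** `T^b L^a ≡ L^a T^b (mod Γ(N))` whenever `N ∣ a b`
(`T^b L^a = (1 + ab, b; a, 1)`, `L^a T^b = (1, b; a, ab + 1)`); hence the slash operators of
`T^b` and `L^a` commute on `Γ(N)`-invariant functions. [folklore] -/
lemma commutator_T_zpow_matL_zpow_mem_Gamma {N : ℕ} (a b : ℤ) (h : (N : ℤ) ∣ a * b) :
    ModularGroup.T ^ b * matL ^ a * (ModularGroup.T ^ b)⁻¹ * (matL ^ a)⁻¹ ∈ Gamma N := by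
  have hab : (a : ZMod N) * (b : ZMod N) = 0 := by
    have := (ZMod.intCast_zmod_eq_zero_iff_dvd (a * b) N).mpr h
    push_cast at this
    exact this
  have heq : ModularGroup.T ^ b * matL ^ a * (ModularGroup.T ^ b)⁻¹ * (matL ^ a)⁻¹ =
      (ModularGroup.T ^ b * matL ^ a) * (matL ^ a * ModularGroup.T ^ b)⁻¹ := by
    rw [_root_.mul_inv_rev, mul_assoc]
  rw [heq]
  refine mul_inv_mem_Gamma_of_forall fun i j ↦ ?_
  simp only [coe_mul, ModularGroup.coe_T_zpow, coe_matL_zpow, Matrix.mul_fin_two]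
  fin_cases i <;> fin_cases j
  · simp only [Fin.zero_eta, Fin.isValue, Matrix.of_apply, Matrix.cons_val', Matrix.cons_val_zero,
      Matrix.empty_val', Matrix.cons_val_fin_one]
    push_cast
    linear_combination hab
  · simp
  · simp
  · simp only [Fin.mk_one, Fin.isValue, Matrix.of_apply, Matrix.cons_val', Matrix.cons_val_one,
      Matrix.empty_val', Matrix.cons_val_fin_one]
    push_cast
    linear_combination -hab

/-! ### Entries of the moves, as scalar identities -/

/-- Entries of `γ T^n`. [folklore] -/
lemma mul_T_zpow_apply (γ : SL(2, ℤ)) (n : ℤ) :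
    (γ * ModularGroup.T ^ n) 0 0 = γ 0 0 ∧ (γ * ModularGroup.T ^ n) 0 1 = γ 0 0 * n + γ 0 1 ∧
      (γ * ModularGroup.T ^ n) 1 0 = γ 1 0 ∧ (γ * ModularGroup.T ^ n) 1 1 = γ 1 0 * n + γ 1 1 := by
  refine ⟨?_, ?_, ?_, ?_⟩ <;> rw [coe_mul_T_zpow] <;> simp

/-- Entries of `L^t γ`. [folklore] -/
lemma matL_zpow_mul_apply (γ : SL(2, ℤ)) (t : ℤ) :
    (matL ^ t * γ) 0 0 = γ 0 0 ∧ (matL ^ t * γ) 0 1 = γ 0 1 ∧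
      (matL ^ t * γ) 1 0 = t * γ 0 0 + γ 1 0 ∧ (matL ^ t * γ) 1 1 = t * γ 0 1 + γ 1 1 := by
  refine ⟨?_, ?_, ?_, ?_⟩ <;> rw [coe_matL_zpow_mul] <;> simp

/-- Entries of `γ L`. [folklore] -/
lemma mul_matL_apply (γ : SL(2, ℤ)) :
    (γ * matL) 0 0 = γ 0 0 + γ 0 1 ∧ (γ * matL) 0 1 = γ 0 1 ∧
      (γ * matL) 1 0 = γ 1 0 + γ 1 1 ∧ (γ * matL) 1 1 = γ 1 1 := by
  refine ⟨?_, ?_, ?_, ?_⟩ <;> rw [coe_mul_matL] <;> simp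

/-- `a d ≡ 1 (mod N)` for `γ = (a b; c d) ∈ SL(2, ℤ)` with `N ∣ b` (or `N ∣ c`). [folklore] -/
lemma cast_mul_cast_eq_one_of_dvd {N : ℕ} (γ : SL(2, ℤ)) (hb : (N : ℤ) ∣ γ 0 1) :
    ((γ 0 0 : ℤ) : ZMod N) * ((γ 1 1 : ℤ) : ZMod N) = 1 := by
  have hdet := Matrix.SpecialLinearGroup.det_coe γ
  rw [Matrix.det_fin_two] at hdet
  have hb' : ((γ 0 1 : ℤ) : ZMod N) = 0 := (ZMod.intCast_zmod_eq_zero_iff_dvd _ N).mpr hb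
  have := congrArg (fun x : ℤ ↦ (x : ZMod N)) hdet
  push_cast at this
  rw [hb', zero_mul, sub_zero] at this
  exact this

/-! ### Diamond–Shurman Lemma 5.7.6: `Γ¹(M) = ⟨Γ(M p), T^M, L⟩` -/

/-- **Generation of `Γ¹(M)` by `Γ(M p)`, `T^M` and `L`** (the inclusion `Γ¹(M) ≤ ⟨…⟩`;
Diamond–Shurman Lemma 5.7.6 and its proof, pp. 215–216, with the prime-to-`p` level `M`
carried along). [cite: DiamondShurman2005, Lemma 5.7.6] -/
theorem gammaUpper1_le_closure (M : ℕ) {p : ℕ} (hp : p.Prime) :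
    gammaUpper1 M ≤
      Subgroup.closure ((Gamma (M * p) : Set SL(2, ℤ)) ∪ {ModularGroup.T ^ M, matL}) := by
  set Δ := Subgroup.closure ((Gamma (M * p) : Set SL(2, ℤ)) ∪ {ModularGroup.T ^ M, matL})
  have hΓ : Gamma (M * p) ≤ Δ := fun x hx ↦ Subgroup.subset_closure (Or.inl hx)
  have hT : ModularGroup.T ^ M ∈ Δ := Subgroup.subset_closure (Or.inr (by simp))
  have hL : matL ∈ Δ := Subgroup.subset_closure (Or.inr (by simp))
  have hTz : ∀ k : ℤ, ModularGroup.T ^ ((M : ℤ) * k) ∈ Δ := fun k ↦ by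
    rw [zpow_mul, zpow_natCast]; exact Δ.zpow_mem hT k
  have hLz : ∀ t : ℤ, matL ^ t ∈ Δ := fun t ↦ Δ.zpow_mem hL t
  have hN : ((M * p : ℕ) : ℤ) = (M : ℤ) * p := by push_cast; ring
  have hMN : (M : ℤ) ∣ ((M * p : ℕ) : ℤ) := ⟨p, hN⟩
  -- Step 4 (Diamond–Shurman's four-factor identity): `b ≡ c ≡ 0 (mod N)` suffices.
  have claimD : ∀ γ : SL(2, ℤ), (M : ℤ) ∣ γ 0 0 - 1 → (M : ℤ) ∣ γ 1 1 - 1 →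
      ((M * p : ℕ) : ℤ) ∣ γ 0 1 → ((M * p : ℕ) : ℤ) ∣ γ 1 0 → γ ∈ Δ := by
    intro γ ha hd hb hc
    obtain ⟨k, hk⟩ := ha
    obtain ⟨l, hl⟩ := hd
    have hX : ModularGroup.T ^ (1 - γ 0 0) * matL ^ (-1 : ℤ) * ModularGroup.T ^ (1 - γ 1 1) *
        matL ^ (γ 0 0 : ℤ) ∈ Δ := by
      refine Δ.mul_mem (Δ.mul_mem (Δ.mul_mem ?_ (hLz _)) ?_) (hLz _)
      · have : (1 - γ 0 0 : ℤ) = (M : ℤ) * (-k) := by linarith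
        rw [this]; exact hTz _
      · have : (1 - γ 1 1 : ℤ) = (M : ℤ) * (-l) := by linarith
        rw [this]; exact hTz _
    refine mem_of_forall_congr hΓ hX fun i j ↦ ?_
    have hb' : ((γ 0 1 : ℤ) : ZMod (M * p)) = 0 := (ZMod.intCast_zmod_eq_zero_iff_dvd _ _).mpr hb
    have hc' : ((γ 1 0 : ℤ) : ZMod (M * p)) = 0 := (ZMod.intCast_zmod_eq_zero_iff_dvd _ _).mpr hc
    have had := cast_mul_cast_eq_one_of_dvd γ hb
    rw [coe_fourFactor]
    fin_cases i <;> fin_cases j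
    · simp only [Fin.zero_eta, Fin.isValue, Matrix.of_apply, Matrix.cons_val', Matrix.cons_val_zero,
        Matrix.empty_val', Matrix.cons_val_fin_one]
      push_cast
      linear_combination ((γ 0 0 : ℤ) : ZMod (M * p)) * had
    · simp only [Fin.zero_eta, Fin.mk_one, Fin.isValue, Matrix.of_apply, Matrix.cons_val',
        Matrix.cons_val_one, Matrix.cons_val_fin_one, Matrix.cons_val_zero, Matrix.empty_val']
      push_cast
      linear_combination hb' + had
    · simp only [Fin.zero_eta, Fin.mk_one, Fin.isValue, Matrix.of_apply, Matrix.cons_val',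
        Matrix.cons_val_zero, Matrix.empty_val', Matrix.cons_val_fin_one, Matrix.cons_val_one]
      push_cast
      linear_combination hc' - had
    · simp
  -- Step 3: clear `c` modulo `N` by a left multiplication with `L^t`.
  have claimC : ∀ γ : SL(2, ℤ), (M : ℤ) ∣ γ 0 0 - 1 → (M : ℤ) ∣ γ 1 1 - 1 →
      ((M * p : ℕ) : ℤ) ∣ γ 0 1 → IsCoprime (γ 0 0 : ℤ) ((M * p : ℕ) : ℤ) → γ ∈ Δ := by
    intro γ ha hd hb hcop
    obtain ⟨u, v, huv⟩ := hcop
    obtain ⟨e00, e01, e10, e11⟩ := matL_zpow_mul_apply γ (-(γ 1 0 * u))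
    have hγ' : matL ^ (-(γ 1 0 * u)) * γ ∈ Δ := by
      refine claimD _ ?_ ?_ ?_ ?_
      · rw [e00]; exact ha
      · rw [e11, add_sub_assoc]
        exact ((hMN.trans hb).mul_left _).add hd
      · rw [e01]; exact hb
      · rw [e10]
        exact ⟨γ 1 0 * v, by linear_combination (-(γ 1 0 : ℤ)) * huv⟩
    have : γ = matL ^ (γ 1 0 * u) * (matL ^ (-(γ 1 0 * u)) * γ) := by
      rw [← mul_assoc, ← zpow_add, add_neg_cancel, zpow_zero, one_mul]
    rw [this]
    exact Δ.mul_mem (hLz _) hγ'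
  -- Step 2: clear `b` modulo `N` by a right multiplication with `T^{Mσ}`.
  have claimB : ∀ γ : SL(2, ℤ), (M : ℤ) ∣ γ 0 0 - 1 → (M : ℤ) ∣ γ 1 1 - 1 →
      (M : ℤ) ∣ γ 0 1 → IsCoprime (γ 0 0 : ℤ) ((M * p : ℕ) : ℤ) → γ ∈ Δ := by
    intro γ ha hd hb hcop
    obtain ⟨u, v, huv⟩ := id hcop
    obtain ⟨b₁, hb₁⟩ := hb
    obtain ⟨e00, e01, e10, e11⟩ := mul_T_zpow_apply γ ((M : ℤ) * -(b₁ * u))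
    have hγ' : γ * ModularGroup.T ^ ((M : ℤ) * -(b₁ * u)) ∈ Δ := by
      refine claimC _ ?_ ?_ ?_ ?_
      · rw [e00]; exact ha
      · rw [e11, add_sub_assoc]
        exact (Dvd.intro (γ 1 0 * -(b₁ * u)) (by ring)).add hd
      · rw [e01, hb₁]
        refine ⟨(M : ℤ) * b₁ * v, ?_⟩
        rw [hN] at huv ⊢
        linear_combination (-(M : ℤ) * b₁) * huv
      · rw [e00]; exact hcop
    have : γ = γ * ModularGroup.T ^ ((M : ℤ) * -(b₁ * u)) *
        ModularGroup.T ^ ((M : ℤ) * (b₁ * u)) := by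
      rw [mul_assoc, ← zpow_add, ← mul_add, neg_add_cancel, mul_zero, zpow_zero, mul_one]
    rw [this]
    exact Δ.mul_mem hγ' (hTz _)
  -- Step 1: arrange `p ∤ a` (right multiplication by `L` if necessary).
  have hcopM : ∀ x : ℤ, (M : ℤ) ∣ x - 1 → IsCoprime x (M : ℤ) := by
    rintro x ⟨k, hk⟩
    exact ⟨1, -k, by linear_combination hk⟩
  have hcopP : ∀ x : ℤ, ¬ (p : ℤ) ∣ x → IsCoprime x (p : ℤ) := fun x hx ↦
    (Int.isCoprime_iff_gcd_eq_one.mpr (Nat.Coprime.symm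
      ((Nat.Prime.coprime_iff_not_dvd hp).mpr (fun h ↦ hx (Int.natCast_dvd.mpr h)))))
  have hcopN : ∀ x : ℤ, (M : ℤ) ∣ x - 1 → ¬ (p : ℤ) ∣ x → IsCoprime x ((M * p : ℕ) : ℤ) :=
    fun x hx hpx ↦ by rw [hN]; exact (hcopM x hx).mul_right (hcopP x hpx)
  intro γ hγ
  obtain ⟨ha, hb, hd⟩ := mem_gammaUpper1_iff_dvd.mp hγ
  by_cases hpa : (p : ℤ) ∣ γ 0 0
  · obtain ⟨e00, e01, e10, e11⟩ := mul_matL_apply γ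
    have hγ' : γ * matL ∈ Δ := by
      refine claimB _ ?_ ?_ ?_ ?_
      · rw [e00, add_sub_right_comm]; exact ha.add hb
      · rw [e11]; exact hd
      · rw [e01]; exact hb
      · rw [e00]
        refine hcopN _ (by rw [add_sub_right_comm]; exact ha.add hb) fun h ↦ ?_
        have hpb : (p : ℤ) ∣ γ 0 1 := by simpa using h.sub hpa
        have hdet := Matrix.SpecialLinearGroup.det_coe γ
        rw [Matrix.det_fin_two] at hdet
        have h1 : (p : ℤ) ∣ 1 := by
          rw [← hdet]; exact (hpa.mul_right _).sub (hpb.mul_right _)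
        exact hp.one_lt.ne' (by exact_mod_cast Int.eq_one_of_dvd_one (by positivity) h1)
    have : γ = γ * matL * matL⁻¹ := by rw [mul_inv_cancel_right]
    rw [this]
    exact Δ.mul_mem hγ' (Δ.inv_mem hL)
  · exact claimB γ ha hd hb (hcopN _ ha hpa)

/-- **Diamond–Shurman Lemma 5.7.6** (in the form with the prime-to-`p` level carried along):
for a prime `p`, the subgroup of `SL(2, ℤ)` generated by `Γ(M p)`, `T^M = (1 M; 0 1)` and
`L = (1 0; 1 1)` is `Γ¹(M) = {γ ≡ (1 0; * 1) mod M}`. (Diamond–Shurman state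
`⟨Γ¹(p^e), Γ₁(p^e) ∩ Γ⁰(p^{e-1})⟩ = Γ¹(p^{e-1})`; modulo `Γ(N)`, `N = M p`, the two subgroups on
the left are generated by `L`, resp. `T^M`.) [cite: DiamondShurman2005, Lemma 5.7.6] -/
theorem closure_eq_gammaUpper1 (M : ℕ) {p : ℕ} (hp : p.Prime) :
    Subgroup.closure ((Gamma (M * p) : Set SL(2, ℤ)) ∪ {ModularGroup.T ^ M, matL}) =
      gammaUpper1 M := by
  refine le_antisymm ((Subgroup.closure_le _).mpr (Set.union_subset ?_ ?_))
    (gammaUpper1_le_closure M hp)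
  · exact Gamma_le_gammaUpper1 (Dvd.intro p rfl)
  · rintro x (rfl | rfl)
    · exact T_pow_mem_gammaUpper1 M
    · exact matL_mem_gammaUpper1 M

/-- Membership form of `closure_eq_gammaUpper1`: a subgroup containing `Γ(M p)`, `T^M` and `L`
contains `Γ¹(M)`. [cite: DiamondShurman2005, Lemma 5.7.6] -/
theorem gammaUpper1_le_of_mem (M : ℕ) {p : ℕ} (hp : p.Prime) {Δ : Subgroup SL(2, ℤ)}
    (hΓ : Gamma (M * p) ≤ Δ) (hT : ModularGroup.T ^ M ∈ Δ) (hL : matL ∈ Δ) :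
    gammaUpper1 M ≤ Δ := by
  refine (gammaUpper1_le_closure M hp).trans ((Subgroup.closure_le _).mpr ?_)
  refine Set.union_subset hΓ ?_
  rintro x (rfl | rfl)
  · exact hT
  · exact hL

/-! ### Bezout: `L ∈ ⨆ᵢ ⟨L^{aᵢ}⟩` when `gcd aᵢ = 1` -/

/-- In any group, `g ∈ ⨆_{i ∈ s} ⟨g^{a i}⟩` as soon as `gcd_{i ∈ s} a i = 1` (the exponents `n`
with `gⁿ` in the join form a subgroup of `ℤ`, which is cyclic). [folklore] -/
theorem mem_biSup_zpowers_pow_of_gcd_eq_one {G : Type*} [Group G] (g : G) {ι : Type*}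
    (s : Finset ι) (a : ι → ℕ) (h : s.gcd a = 1) :
    g ∈ ⨆ i ∈ s, Subgroup.zpowers (g ^ a i) := by
  set Z := ⨆ i ∈ s, Subgroup.zpowers (g ^ a i)
  -- the exponents `n` with `g ^ n ∈ Z` form a subgroup of `ℤ`
  let D : AddSubgroup ℤ :=
    { carrier := {n | g ^ n ∈ Z}
      zero_mem' := by simp [Z.one_mem]
      add_mem' := fun {m n} hm hn ↦ by
        simp only [Set.mem_setOf_eq, zpow_add] at hm hn ⊢
        exact Z.mul_mem hm hn
      neg_mem' := fun {n} hn ↦ by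
        simp only [Set.mem_setOf_eq, zpow_neg] at hn ⊢
        exact Z.inv_mem hn }
  have ha : ∀ i ∈ s, (a i : ℤ) ∈ D := fun i hi ↦ by
    show g ^ (a i : ℤ) ∈ Z
    rw [zpow_natCast]
    exact (le_biSup (fun i ↦ Subgroup.zpowers (g ^ a i)) hi) (Subgroup.mem_zpowers _)
  obtain ⟨d, hd⟩ := Int.subgroup_cyclic D
  have hdvd : ∀ i ∈ s, d.natAbs ∣ a i := fun i hi ↦ by
    have := ha i hi
    rw [hd, ← AddSubgroup.zmultiples_eq_closure, Int.mem_zmultiples_iff] at this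
    exact Int.natAbs_dvd_natAbs.mpr this
  have hd1 : d.natAbs = 1 := Nat.dvd_one.mp (h ▸ Finset.dvd_gcd hdvd)
  have hdD : d ∈ D := by
    rw [hd, ← AddSubgroup.zmultiples_eq_closure]; exact AddSubgroup.mem_zmultiples d
  have h1 : (1 : ℤ) ∈ D := by
    rcases Int.natAbs_eq_iff.mp hd1 with h | h
    · rwa [h] at hdD
    · have := D.neg_mem hdD
      rw [h, neg_neg] at this
      exact this
  have : g ^ (1 : ℤ) ∈ Z := h1
  rwa [zpow_one] at this

/-- `L ∈ ⨆_{i ∈ s} ⟨L^{a i}⟩` when `gcd_{i ∈ s} a i = 1`. [folklore] -/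
theorem matL_mem_biSup_zpowers {ι : Type*} (s : Finset ι) (a : ι → ℕ) (h : s.gcd a = 1) :
    matL ∈ ⨆ i ∈ s, Subgroup.zpowers (matL ^ a i) :=
  mem_biSup_zpowers_pow_of_gcd_eq_one matL s a h

/-- `gcd_{q ∣ N prime} N / q^{v_q(N)} = 1` for `N ≥ 2`. [folklore] -/
theorem _root_.Nat.gcd_primeFactors_ordCompl_eq_one {N : ℕ} (hN : 2 ≤ N) :
    N.primeFactors.gcd (fun q ↦ N / q ^ N.factorization q) = 1 := by
  have hN0 : N ≠ 0 := by omega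
  rw [Nat.eq_one_iff_not_exists_prime_dvd]
  intro r hr hrg
  obtain ⟨q, hq⟩ := (Nat.nonempty_primeFactors.mpr hN)
  have hrN : r ∣ N := by
    refine hrg.trans ((Finset.gcd_dvd hq).trans ?_)
    exact Nat.div_dvd_of_dvd (Nat.ordProj_dvd N q)
  have hrmem : r ∈ N.primeFactors := Nat.mem_primeFactors.mpr ⟨hr, hrN, hN0⟩
  have h1 : r ∣ N / r ^ N.factorization r := hrg.trans (Finset.gcd_dvd hrmem)
  have h2 : Nat.Coprime r (N / r ^ N.factorization r) := Nat.coprime_ordCompl hr hN0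
  exact hr.one_lt.ne' (h2.eq_one_of_dvd h1)

end Literature.NumberTheory.EllipticCurves.ModularForms
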